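import Summits.QuantumFields.YangMills.Theorems.FemtoTransferGapRungW1upDeficit
import Summits.QuantumFields.YangMills.Theorems.LuscherReductionOneSiteLevelsMagnetic
import Summits.QuantumFields.YangMills.Theorems.LuscherReductionOneSiteLevelsPhysClass

/-!
# Femto transfer gap — rung W1-up, part 4/7: the one-site lattice: Schur bound and physical product states

Support module of the `FemtoTransferGap` group (cell `ym-beyond`, seat P1; route `LuscherReduction`, crux `OneSiteLevels` =
`stmt-QuantumFields-20007`), part 4/7 of the sorry-free proof of the registered BC5 rung `RungUpperK1` (`stub_rungW1up`):
`∃ C B0, ∀ B ≥ B0, e^{−C λ_b(B)} λ₀(B,1) ≤ λ₁(B,1)` on the ONE-SITE lattice (`rungUpperK1` in `FemtoTransferGapRungW1up`).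

The one-site lattice `L = 1`: the electric kernel `E_B(U,V) = ∏ₑ w_B(Uₑ Vₑ⁻¹)` (`linkE`) with `K_B ≤ E_B` and
`K_B ≥ e^{−B s₀} E_B` where the Wilson action is `≤ s₀`; row sums `∫ E_B(U,·) = c_B^{|E|}` (`linkCE`); the SCHUR BOUND
`topValue su2Rep 1 B ≤ c_B^{|E|}` (`topValue_le_linkCE`); PHYSICAL PRODUCT STATES `U ↦ ∏ₑ fₑ(Uₑ)` of class functions invariant under
the centre (`isPhys_linkProduct`), linear combinations, and the factorisations `⟨⊗f, E_B ⊗f'⟩ = ∏ₑ q_B(fₑ,f'ₑ)`, `⟨⊗f, ⊗f'⟩ = ∏ₑ ∫ fₑ f'ₑ`.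

## WHAT THIS IS NOT
NOT THE CLAY GAP; no statement about `L → ∞` or a continuum limit.  Everything below is proved (no `sorry`, no new axiom).
-/

set_option autoImplicit false

noncomputable section

open MeasureTheory Filter Topology Real
open scoped Matrix ComplexConjugate
open Literature.MathematicalPhysics.QuantumFieldTheory
open Literature.MathematicalPhysics.QuantumLattice

namespace Summit.QuantumFields.YangMills.Theorems.FemtoTransferGap

/-! ## Part C. The one-site lattice `L = 1`: factorisation of the kernel, Schur bound `λ₀ ≤ c_B^{|E|}`, physical product states

`Cfg = GaugeConfig 3 1 SU2` (three links), `μ = configMeasure SU2 1 = σ^{⊗E}`.  The transfer kernel is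
`K_B(U,V) = E_B(U,V) · exp(−(B/2)(S(U)+S(V)))` with `E_B(U,V) = ∏ₑ w_B(Uₑ Vₑ⁻¹)` and `S ≥ 0` the magnetic (Wilson) energy, so
`K_B ≤ E_B` and `K_B ≥ e^{−B s₀} E_B` where `S ≤ s₀`; row and column sums of `E_B` are `c_B^{|E|}`. -/

/-- The one-site configuration space (three spatial links). [folklore] -/
abbrev Cfg : Type := GaugeConfig 3 1 SU2

/-- **Electric factor** `E_B(U,V) = ∏ₑ w_B(Uₑ Vₑ⁻¹)` of the transfer kernel. [cite: SeilerLNP1982, §3] -/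
def linkE (B : ℝ) (U V : Cfg) : ℝ := ∏ e : Edge 3 1, linkW B (U e * (V e)⁻¹)

/-- `0 < E_B`. [folklore] -/
theorem linkE_pos (B : ℝ) (U V : Cfg) : 0 < linkE B U V := Finset.prod_pos fun _ _ => linkW_pos B _

/-- `E_B = exp(B · timeCoupling)`. [folklore] -/
theorem linkE_eq_exp (B : ℝ) (U V : Cfg) : linkE B U V = Real.exp (B * timeCoupling su2Rep U V) := by
  unfold linkE linkW timeCoupling
  rw [Finset.mul_sum, Real.exp_sum]
  simp

/-- `E_B ≤ e^{2B|E|}` (`B ≥ 0`). [folklore] -/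
theorem linkE_le {B : ℝ} (hB : 0 ≤ B) (U V : Cfg) : linkE B U V ≤ Real.exp (2 * B) ^ Fintype.card (Edge 3 1) := by
  unfold linkE
  calc ∏ e, linkW B (U e * (V e)⁻¹) ≤ ∏ _e : Edge 3 1, Real.exp (2 * B) :=
        Finset.prod_le_prod (fun e _ => (linkW_pos B _).le) fun e _ => linkW_le hB _
    _ = Real.exp (2 * B) ^ Fintype.card (Edge 3 1) := by rw [Finset.prod_const, Finset.card_univ]

/-- `|E_B| ≤ e^{2B|E|}` (`B ≥ 0`). [folklore] -/
theorem abs_linkE_le {B : ℝ} (hB : 0 ≤ B) (U V : Cfg) : |linkE B U V| ≤ Real.exp (2 * B) ^ Fintype.card (Edge 3 1) := by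
  rw [abs_of_pos (linkE_pos B U V)]; exact linkE_le hB U V

/-- `E_B` is jointly continuous. [folklore] -/
theorem continuous_linkE (B : ℝ) : Continuous fun p : Cfg × Cfg => linkE B p.1 p.2 := by
  unfold linkE
  exact continuous_finsetProd _ fun e _ => (continuous_linkW B).comp
    (((continuous_apply e).comp continuous_fst).mul ((continuous_apply e).comp continuous_snd).inv)

/-- `E_B` is jointly measurable. [folklore] -/
theorem measurable_linkE (B : ℝ) : Measurable fun p : Cfg × Cfg => linkE B p.1 p.2 := by
  haveI := secondCountableTopology_su2
  exact (continuous_linkE B).measurable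

/-- The `SU(2)` Wilson action is non-negative. [folklore] -/
theorem wilsonAction_su2_nonneg (U : Cfg) : 0 ≤ wilsonAction su2Rep U := by
  unfold wilsonAction
  refine Finset.sum_nonneg fun p _ => ?_
  have h := re_trace_le_two (plaquetteHolonomy U p.1 p.2.1.1 p.2.1.2)
  simp only [fundamentalRep_apply, Nat.cast_ofNat]
  linarith

/-- One plaquette term is `≤ 2 t⁴` when all links are within vacuum-distance `t`. [folklore] -/
theorem plaquetteTerm_le (U : Cfg) {t : ℝ} (hU : ∀ e, vacDist (U e) ≤ t) (x : Site 3 1) (i j : Fin 3) :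
    2 - ((su2Rep (plaquetteHolonomy U x i j)).trace).re ≤ 2 * t ^ 2 * t ^ 2 := by
  rw [plaquetteHolonomy_one_site, fundamentalRep_apply]
  have h := two_sub_re_trace_comm_le_vacDist (U (x, i)) (U (x, j))
  have ha : vacDist (U (x, i)) ^ 2 ≤ t ^ 2 := pow_le_pow_left₀ (vacDist_nonneg _) (hU _) 2
  have hb : vacDist (U (x, j)) ^ 2 ≤ t ^ 2 := pow_le_pow_left₀ (vacDist_nonneg _) (hU _) 2
  have hab := mul_le_mul ha hb (sq_nonneg _) (sq_nonneg t)
  nlinarith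

/-- **Magnetic energy is small near the vacuum**: `S(U) ≤ |P| · 2 t⁴` when all links are within vacuum-distance `t`. [folklore] -/
theorem wilsonAction_le_of_vacDist (U : Cfg) {t : ℝ} (hU : ∀ e, vacDist (U e) ≤ t) :
    wilsonAction su2Rep U ≤ (Fintype.card (Plaquette 3 1) : ℝ) * (2 * t ^ 2 * t ^ 2) := by
  have h1 : wilsonAction su2Rep U = ∑ p : Plaquette 3 1, (2 - ((su2Rep (plaquetteHolonomy U p.1 p.2.1.1 p.2.1.2)).trace).re) := by
    unfold wilsonAction; simp
  rw [h1]
  calc ∑ p : Plaquette 3 1, (2 - ((su2Rep (plaquetteHolonomy U p.1 p.2.1.1 p.2.1.2)).trace).re)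
      ≤ ∑ _p : Plaquette 3 1, (2 * t ^ 2 * t ^ 2 : ℝ) := Finset.sum_le_sum fun p _ => plaquetteTerm_le U hU _ _ _
    _ = (Fintype.card (Plaquette 3 1) : ℝ) * (2 * t ^ 2 * t ^ 2) := by
        rw [Finset.sum_const, Finset.card_univ, nsmul_eq_mul]

/-- `K_B = E_B · exp(−(B/2)(S(U)+S(V)))`. [folklore] -/
theorem transferKernel_eq_linkE_mul (B : ℝ) (U V : Cfg) : transferKernel su2Rep B U V =
    linkE B U V * Real.exp (-(B / 2) * (wilsonAction su2Rep U + wilsonAction su2Rep V)) := by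
  rw [transferKernel, linkE_eq_exp, ← Real.exp_add]
  congr 1; ring

/-- **`K_B ≤ E_B`** (`B ≥ 0`; the magnetic Boltzmann factor is `≤ 1`). [folklore] -/
theorem transferKernel_le_linkE {B : ℝ} (hB : 0 ≤ B) (U V : Cfg) : transferKernel su2Rep B U V ≤ linkE B U V := by
  rw [transferKernel_eq_linkE_mul]
  have hS := add_nonneg (wilsonAction_su2_nonneg U) (wilsonAction_su2_nonneg V)
  have h1 : Real.exp (-(B / 2) * (wilsonAction su2Rep U + wilsonAction su2Rep V)) ≤ 1 :=
    Real.exp_le_one_iff.mpr (by nlinarith)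
  calc linkE B U V * Real.exp (-(B / 2) * (wilsonAction su2Rep U + wilsonAction su2Rep V))
      ≤ linkE B U V * 1 := mul_le_mul_of_nonneg_left h1 (linkE_pos B U V).le
    _ = linkE B U V := mul_one _

/-- **`K_B ≥ e^{−B s₀} E_B`** where both magnetic energies are `≤ s₀`. [folklore] -/
theorem exp_mul_linkE_le_transferKernel {B : ℝ} (hB : 0 ≤ B) {s₀ : ℝ} {U V : Cfg}
    (hU : wilsonAction su2Rep U ≤ s₀) (hV : wilsonAction su2Rep V ≤ s₀) :
    Real.exp (-(B * s₀)) * linkE B U V ≤ transferKernel su2Rep B U V := by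
  rw [transferKernel_eq_linkE_mul, mul_comm]
  refine mul_le_mul_of_nonneg_left (Real.exp_le_exp.2 ?_) (linkE_pos B U V).le
  nlinarith

/-- `|K_B| ≤ e^{2B|E|}` (`B ≥ 0`). [folklore] -/
theorem abs_transferKernel_le {B : ℝ} (hB : 0 ≤ B) (p : Cfg × Cfg) :
    |transferKernel su2Rep B p.1 p.2| ≤ Real.exp (2 * B) ^ Fintype.card (Edge 3 1) := by
  rw [abs_of_pos (transferKernel_pos _ _ _ _)]
  exact (transferKernel_le_linkE hB _ _).trans (linkE_le hB _ _)

/-- `K_B` is jointly measurable. [folklore] -/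
theorem measurable_transferKernel_su2 (B : ℝ) : Measurable fun p : Cfg × Cfg => transferKernel su2Rep B p.1 p.2 := by
  haveI := secondCountableTopology_su2
  exact (continuous_transferKernel su2Rep continuous_su2Rep B).measurable

/-! ### C.2 Row and column sums of `E_B` -/

/-- `c_B^{|E|}`, the row sum of the electric factor. [folklore] -/
def linkCE (B : ℝ) : ℝ := linkC B ^ Fintype.card (Edge 3 1)

/-- `0 < c_B^{|E|}` (`B ≥ 0`). [folklore] -/
theorem linkCE_pos {B : ℝ} (hB : 0 ≤ B) : 0 < linkCE B := pow_pos (linkC_pos hB) _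

/-- Row sum: `∫ E_B(U,V) dμ(V) = c_B^{|E|}`. [folklore] -/
theorem integral_linkE_snd (B : ℝ) (U : Cfg) : ∫ V, linkE B U V ∂configMeasure SU2 1 = linkCE B := by
  unfold linkE linkCE
  rw [show (∫ V, ∏ e, linkW B (U e * (V e)⁻¹) ∂configMeasure SU2 1) =
      ∏ e : Edge 3 1, ∫ v, linkW B (U e * v⁻¹) ∂haarProbability SU2 from
    integral_fintype_prod_eq_prod (fun e v => linkW B (U e * v⁻¹))]
  rw [Finset.prod_congr rfl fun e _ => integral_comp_mul_inv_left (linkW B) (U e), Finset.prod_const, Finset.card_univ]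
  rfl

/-- Column sum: `∫ E_B(U,V) dμ(U) = c_B^{|E|}`. [folklore] -/
theorem integral_linkE_fst (B : ℝ) (V : Cfg) : ∫ U, linkE B U V ∂configMeasure SU2 1 = linkCE B := by
  unfold linkE linkCE
  rw [show (∫ U, ∏ e, linkW B (U e * (V e)⁻¹) ∂configMeasure SU2 1) =
      ∏ e : Edge 3 1, ∫ u, linkW B (u * (V e)⁻¹) ∂haarProbability SU2 from
    integral_fintype_prod_eq_prod (fun e u => linkW B (u * (V e)⁻¹))]
  rw [Finset.prod_congr rfl fun e _ => integral_comp_mul_inv_right (linkW B) (V e), Finset.prod_const, Finset.card_univ]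
  rfl

/-- A bounded measurable function on `Cfg × Cfg` is integrable. [folklore] -/
theorem integrable_cfgProd {F : Cfg × Cfg → ℝ} (hF : Measurable F) {C : ℝ} (hC : ∀ p, |F p| ≤ C) :
    Integrable F ((configMeasure SU2 1).prod (configMeasure SU2 1)) :=
  integrable_of_measurable_abs_le _ hF hC

/-- Sandwich integrability `f(U) H(U,V) f'(V)` for bounded measurable data. [folklore] -/
theorem integrable_sandwich' {H : Cfg × Cfg → ℝ} (hH : Measurable H) {R : ℝ} (hR : ∀ p, |H p| ≤ R)
    {f f' : Cfg → ℝ} (hf : Measurable f) (hf' : Measurable f') {C C' : ℝ} (hfb : ∀ U, |f U| ≤ C) (hf'b : ∀ V, |f' V| ≤ C') :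
    Integrable (fun p : Cfg × Cfg => f p.1 * H p * f' p.2) ((configMeasure SU2 1).prod (configMeasure SU2 1)) := by
  refine integrable_cfgProd (((hf.comp measurable_fst).mul hH).mul (hf'.comp measurable_snd)) (C := C * R * C') fun p => ?_
  rw [abs_mul, abs_mul]
  have hC : 0 ≤ C := (abs_nonneg _).trans (hfb p.1)
  exact mul_le_mul (mul_le_mul (hfb _) (hR _) (abs_nonneg _) hC) (hf'b _) (abs_nonneg _)
    (mul_nonneg hC ((abs_nonneg _).trans (hR p)))

/-- **Row identity** `∫∫ E_B(U,V) Φ(U) = c_B^{|E|} ∫ Φ`. [folklore] -/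
theorem integral_prod_linkE_mul_fst (B : ℝ) {Φ : Cfg → ℝ} (hΦ : Measurable Φ) {C : ℝ} (hΦb : ∀ U, |Φ U| ≤ C) (hB : 0 ≤ B) :
    ∫ p, linkE B p.1 p.2 * Φ p.1 ∂(configMeasure SU2 1).prod (configMeasure SU2 1) =
      linkCE B * ∫ U, Φ U ∂configMeasure SU2 1 := by
  have hint : Integrable (fun p : Cfg × Cfg => linkE B p.1 p.2 * Φ p.1) ((configMeasure SU2 1).prod (configMeasure SU2 1)) := by
    refine integrable_cfgProd ((measurable_linkE B).mul (hΦ.comp measurable_fst))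
      (C := Real.exp (2 * B) ^ Fintype.card (Edge 3 1) * C) fun p => ?_
    rw [abs_mul]; exact mul_le_mul (abs_linkE_le hB _ _) (hΦb _) (abs_nonneg _) (by positivity)
  rw [integral_prod _ hint]
  have inner : ∀ U : Cfg, ∫ V, linkE B U V * Φ U ∂configMeasure SU2 1 = linkCE B * Φ U := fun U => by
    rw [integral_mul_const, integral_linkE_snd]
  simp only [inner]
  rw [integral_const_mul]

/-- **Column identity** `∫∫ E_B(U,V) Φ(V) = c_B^{|E|} ∫ Φ`. [folklore] -/
theorem integral_prod_linkE_mul_snd (B : ℝ) {Φ : Cfg → ℝ} (hΦ : Measurable Φ) {C : ℝ} (hΦb : ∀ U, |Φ U| ≤ C) (hB : 0 ≤ B) :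
    ∫ p, linkE B p.1 p.2 * Φ p.2 ∂(configMeasure SU2 1).prod (configMeasure SU2 1) =
      linkCE B * ∫ V, Φ V ∂configMeasure SU2 1 := by
  have hint : Integrable (fun p : Cfg × Cfg => linkE B p.1 p.2 * Φ p.2) ((configMeasure SU2 1).prod (configMeasure SU2 1)) := by
    refine integrable_cfgProd ((measurable_linkE B).mul (hΦ.comp measurable_snd))
      (C := Real.exp (2 * B) ^ Fintype.card (Edge 3 1) * C) fun p => ?_
    rw [abs_mul]; exact mul_le_mul (abs_linkE_le hB _ _) (hΦb _) (abs_nonneg _) (by positivity)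
  rw [integral_prod_symm _ hint]
  have inner : ∀ V : Cfg, ∫ U, linkE B U V * Φ V ∂configMeasure SU2 1 = linkCE B * Φ V := fun V => by
    rw [integral_mul_const, integral_linkE_fst]
  simp only [inner]
  rw [integral_const_mul]

/-! ### C.3 The Schur bound `λ₀(B,1) ≤ c_B^{|E|}` -/

/-- `⟨ψ, K_B ψ⟩` as a product integral, for a physical `ψ`. [folklore] -/
theorem qform_eq_integral_cfgProd {B : ℝ} (hB : 0 ≤ B) {ψ : Cfg → ℝ} (hψ : IsPhys ψ) :
    qform su2Rep B ψ ψ = ∫ p, ψ p.1 * transferKernel su2Rep B p.1 p.2 * ψ p.2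
      ∂(configMeasure SU2 1).prod (configMeasure SU2 1) := by
  obtain ⟨C, hC⟩ := hψ.bounded
  exact (integral_prod _ (integrable_sandwich' (measurable_transferKernel_su2 B) (abs_transferKernel_le hB)
    hψ.measurable hψ.measurable hC hC)).symm

/-- **Schur test**: `⟨ψ, K_B ψ⟩ ≤ c_B^{|E|} ‖ψ‖²` for every physical `ψ` (`ψ(U)K ψ(V) ≤ E_B (ψ(U)² + ψ(V)²)/2`, row and column sums).
[folklore] -/
theorem qform_le_linkCE_mul_l2 {B : ℝ} (hB : 0 ≤ B) {ψ : Cfg → ℝ} (hψ : IsPhys ψ) :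
    qform su2Rep B ψ ψ ≤ linkCE B * l2 ψ ψ := by
  obtain ⟨C, hC⟩ := hψ.bounded
  have hm := hψ.measurable
  have hψ2m : Measurable fun U => ψ U ^ 2 := hm.pow_const 2
  have hψ2b : ∀ U, |ψ U ^ 2| ≤ C ^ 2 := fun U => by
    rw [abs_pow]; exact pow_le_pow_left₀ (abs_nonneg _) (hC U) 2
  have e1 := integral_prod_linkE_mul_fst B hψ2m hψ2b hB
  have e2 := integral_prod_linkE_mul_snd B hψ2m hψ2b hB
  have hG1 : Integrable (fun p : Cfg × Cfg => linkE B p.1 p.2 * ψ p.1 ^ 2) ((configMeasure SU2 1).prod (configMeasure SU2 1)) := by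
    refine integrable_cfgProd ((measurable_linkE B).mul (hψ2m.comp measurable_fst))
      (C := Real.exp (2 * B) ^ Fintype.card (Edge 3 1) * C ^ 2) fun p => ?_
    rw [abs_mul]; exact mul_le_mul (abs_linkE_le hB _ _) (hψ2b _) (abs_nonneg _) (by positivity)
  have hG2 : Integrable (fun p : Cfg × Cfg => linkE B p.1 p.2 * ψ p.2 ^ 2) ((configMeasure SU2 1).prod (configMeasure SU2 1)) := by
    refine integrable_cfgProd ((measurable_linkE B).mul (hψ2m.comp measurable_snd))
      (C := Real.exp (2 * B) ^ Fintype.card (Edge 3 1) * C ^ 2) fun p => ?_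
    rw [abs_mul]; exact mul_le_mul (abs_linkE_le hB _ _) (hψ2b _) (abs_nonneg _) (by positivity)
  have hG : Integrable (fun p : Cfg × Cfg => (1 / 2 : ℝ) * (linkE B p.1 p.2 * ψ p.1 ^ 2) +
      (1 / 2 : ℝ) * (linkE B p.1 p.2 * ψ p.2 ^ 2)) ((configMeasure SU2 1).prod (configMeasure SU2 1)) :=
    (hG1.const_mul _).add (hG2.const_mul _)
  have hF := integrable_sandwich' (measurable_transferKernel_su2 B) (abs_transferKernel_le hB) hm hm hC hC
  have hpt : ∀ p : Cfg × Cfg, ψ p.1 * transferKernel su2Rep B p.1 p.2 * ψ p.2 ≤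
      (1 / 2 : ℝ) * (linkE B p.1 p.2 * ψ p.1 ^ 2) + (1 / 2 : ℝ) * (linkE B p.1 p.2 * ψ p.2 ^ 2) := by
    intro p
    have hK := transferKernel_pos su2Rep B p.1 p.2
    have hKE := transferKernel_le_linkE hB p.1 p.2
    have a1 : ψ p.1 * ψ p.2 * transferKernel su2Rep B p.1 p.2 ≤
        (1 / 2 : ℝ) * (ψ p.1 ^ 2 + ψ p.2 ^ 2) * transferKernel su2Rep B p.1 p.2 :=
      mul_le_mul_of_nonneg_right (by nlinarith [sq_nonneg (ψ p.1 - ψ p.2)]) hK.le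
    have a2 : (1 / 2 : ℝ) * (ψ p.1 ^ 2 + ψ p.2 ^ 2) * transferKernel su2Rep B p.1 p.2 ≤
        (1 / 2 : ℝ) * (ψ p.1 ^ 2 + ψ p.2 ^ 2) * linkE B p.1 p.2 :=
      mul_le_mul_of_nonneg_left hKE (by positivity)
    have e : ψ p.1 * transferKernel su2Rep B p.1 p.2 * ψ p.2 = ψ p.1 * ψ p.2 * transferKernel su2Rep B p.1 p.2 := by ring
    rw [e]; linarith
  have hl2 : l2 ψ ψ = ∫ U, ψ U ^ 2 ∂configMeasure SU2 1 := by
    unfold l2; congr 1; funext U; ring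
  rw [qform_eq_integral_cfgProd hB hψ]
  calc ∫ p, ψ p.1 * transferKernel su2Rep B p.1 p.2 * ψ p.2 ∂(configMeasure SU2 1).prod (configMeasure SU2 1)
      ≤ ∫ p, (1 / 2 : ℝ) * (linkE B p.1 p.2 * ψ p.1 ^ 2) + (1 / 2 : ℝ) * (linkE B p.1 p.2 * ψ p.2 ^ 2)
          ∂(configMeasure SU2 1).prod (configMeasure SU2 1) := integral_mono hF hG hpt
    _ = (1 / 2 : ℝ) * (linkCE B * ∫ U, ψ U ^ 2 ∂configMeasure SU2 1) +
          (1 / 2 : ℝ) * (linkCE B * ∫ U, ψ U ^ 2 ∂configMeasure SU2 1) := by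
        rw [integral_add (hG1.const_mul _) (hG2.const_mul _), integral_const_mul, integral_const_mul, e1, e2]
    _ = linkCE B * l2 ψ ψ := by rw [hl2]; ring

/-- The Rayleigh quotient of the constant `1` lies in every Rayleigh set with the trivial constraint. [folklore] -/
theorem one_mem_rayleighSet (B : ℝ) :
    qform su2Rep B (L := 1) (fun _ => (1 : ℝ)) (fun _ => 1) / l2 (G := SU2) (L := 1) (fun _ => (1 : ℝ)) (fun _ => 1) ∈
      rayleighSet su2Rep 1 B (fun _ => True) := by
  have hl2 : l2 (G := SU2) (L := 1) (fun _ => (1 : ℝ)) (fun _ => 1) = 1 := by simp [l2]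
  exact ⟨fun _ => 1, isPhys_const 1, trivial, by rw [hl2]; exact one_pos, rfl⟩

/-- **Schur bound for the top value**: `λ₀(B, 1) ≤ c_B^{|E|}` (`B ≥ 0`). [folklore] -/
theorem topValue_le_linkCE {B : ℝ} (hB : 0 ≤ B) : topValue su2Rep 1 B ≤ linkCE B := by
  unfold topValue
  refine csSup_le ⟨_, one_mem_rayleighSet B⟩ ?_
  rintro r ⟨ψ, hψ, -, hpos, rfl⟩
  rw [div_le_iff₀ hpos]
  exact qform_le_linkCE_mul_l2 hB hψ

/-! ### C.4 Physical product states and the factorisation of `⟨·, E_B ·⟩` -/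

/-- **Physical product states**: a product over the links of continuous, `[0,1]`-valued, conjugation- and centre-invariant one-link
profiles is a physical zero-flux test function on one site. [folklore] -/
theorem isPhys_linkProduct (f : Edge 3 1 → SU2 → ℝ) (hfc : ∀ e, Continuous (f e)) (hf0 : ∀ e W, 0 ≤ f e W)
    (hf1 : ∀ e W, f e W ≤ 1) (hconj : ∀ e (g W : SU2), f e (g * W * g⁻¹) = f e W)
    (hcen : ∀ e (z : SU2), z ∈ Subgroup.center SU2 → ∀ W, f e (z * W) = f e W) :
    IsPhys (fun U : Cfg => ∏ e, f e (U e)) where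
  measurable := by
    haveI := secondCountableTopology_su2
    exact (continuous_finsetProd _ fun e _ => (hfc e).comp (continuous_apply e)).measurable
  bounded := ⟨1, fun U => by
    rw [Finset.abs_prod]
    calc ∏ e, |f e (U e)| ≤ ∏ _e : Edge 3 1, (1 : ℝ) :=
          Finset.prod_le_prod (fun e _ => abs_nonneg _) fun e _ => by rw [abs_of_nonneg (hf0 e _)]; exact hf1 e _
      _ = 1 := by simp⟩
  gaugeInv := fun g U => Finset.prod_congr rfl fun e _ => by rw [gaugeTransform_one_site, hconj]
  zeroFlux := fun k z hz U => by
    refine Finset.prod_congr rfl fun e _ => ?_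
    unfold twist
    split_ifs
    · exact hcen e z hz _
    · rfl

/-- Linear combinations of physical test functions are physical. [folklore] -/
theorem isPhys_lincomb {ψ φ : Cfg → ℝ} (hψ : IsPhys ψ) (hφ : IsPhys φ) (a b : ℝ) :
    IsPhys (fun U => a * ψ U - b * φ U) where
  measurable := (hψ.measurable.const_mul a).sub (hφ.measurable.const_mul b)
  bounded := by
    obtain ⟨C, hC⟩ := hψ.bounded
    obtain ⟨D, hD⟩ := hφ.bounded
    refine ⟨|a| * C + |b| * D, fun U => ?_⟩
    calc |a * ψ U - b * φ U| ≤ |a * ψ U| + |b * φ U| := abs_sub _ _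
      _ = |a| * |ψ U| + |b| * |φ U| := by rw [abs_mul, abs_mul]
      _ ≤ |a| * C + |b| * D :=
          add_le_add (mul_le_mul_of_nonneg_left (hC U) (abs_nonneg a)) (mul_le_mul_of_nonneg_left (hD U) (abs_nonneg b))
  gaugeInv := fun g U => by simp only [hψ.gaugeInv, hφ.gaugeInv]
  zeroFlux := fun k z hz U => by simp only [hψ.zeroFlux k z hz, hφ.zeroFlux k z hz]

/-- `l2` is linear in the first slot (physical data). [folklore] -/
theorem l2_lincomb_left {ψ φ χ : Cfg → ℝ} (hψ : IsPhys ψ) (hφ : IsPhys φ) (hχ : IsPhys χ) (a b : ℝ) :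
    l2 (fun U => a * ψ U - b * φ U) χ = a * l2 ψ χ - b * l2 φ χ := by
  obtain ⟨C, hC⟩ := hψ.bounded
  obtain ⟨D, hD⟩ := hφ.bounded
  obtain ⟨E, hE⟩ := hχ.bounded
  unfold l2
  have i1 : Integrable (fun U => ψ U * χ U) (configMeasure SU2 1) := by
    refine integrable_of_measurable_abs_le _ (hψ.measurable.mul hχ.measurable) (C := C * E) fun U => ?_
    rw [abs_mul]; exact mul_le_mul (hC U) (hE U) (abs_nonneg _) ((abs_nonneg _).trans (hC U))
  have i2 : Integrable (fun U => φ U * χ U) (configMeasure SU2 1) := by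
    refine integrable_of_measurable_abs_le _ (hφ.measurable.mul hχ.measurable) (C := D * E) fun U => ?_
    rw [abs_mul]; exact mul_le_mul (hD U) (hE U) (abs_nonneg _) ((abs_nonneg _).trans (hD U))
  have h : (fun U => (a * ψ U - b * φ U) * χ U) = fun U => a * (ψ U * χ U) - b * (φ U * χ U) := by
    funext U; ring
  rw [h, integral_sub (i1.const_mul a) (i2.const_mul b), integral_const_mul, integral_const_mul]

/-- **Electric form** `⟨f, E_B f'⟩ = ∫∫ f(U) E_B(U,V) f'(V)`. [folklore] -/
def qE (B : ℝ) (f f' : Cfg → ℝ) : ℝ :=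
  ∫ U, ∫ V, f U * linkE B U V * f' V ∂configMeasure SU2 1 ∂configMeasure SU2 1

/-- `⟨f, E_B f'⟩` as a product integral. [folklore] -/
theorem qE_eq_integral_prod {B : ℝ} (hB : 0 ≤ B) {f f' : Cfg → ℝ} (hf : Measurable f) (hf' : Measurable f')
    {C C' : ℝ} (hfb : ∀ U, |f U| ≤ C) (hf'b : ∀ V, |f' V| ≤ C') :
    qE B f f' = ∫ p, f p.1 * linkE B p.1 p.2 * f' p.2 ∂(configMeasure SU2 1).prod (configMeasure SU2 1) :=
  (integral_prod _ (integrable_sandwich' (measurable_linkE B) (fun p => abs_linkE_le hB p.1 p.2) hf hf' hfb hf'b)).symm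

/-- **Factorisation**: for product states `⟨⊗f, E_B ⊗f'⟩ = ∏ₑ q_B(fₑ, f'ₑ)`. [folklore] -/
theorem qE_linkProduct (B : ℝ) (f f' : Edge 3 1 → SU2 → ℝ) :
    qE B (fun U => ∏ e, f e (U e)) (fun V => ∏ e, f' e (V e)) = ∏ e, linkQ B (f e) (f' e) := by
  unfold qE linkE
  have inner : ∀ U : Cfg, ∫ V, (∏ e, f e (U e)) * (∏ e, linkW B (U e * (V e)⁻¹)) * ∏ e, f' e (V e) ∂configMeasure SU2 1 =
      ∏ e, (f e (U e) * ∫ v, linkW B (U e * v⁻¹) * f' e v ∂haarProbability SU2) := by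
    intro U
    have h1 : ∀ V : Cfg, (∏ e, f e (U e)) * (∏ e, linkW B (U e * (V e)⁻¹)) * ∏ e, f' e (V e) =
        ∏ e, (f e (U e) * (linkW B (U e * (V e)⁻¹) * f' e (V e))) := fun V => by
      rw [← Finset.prod_mul_distrib, ← Finset.prod_mul_distrib]
      exact Finset.prod_congr rfl fun e _ => by ring
    simp_rw [h1]
    rw [show (∫ V, ∏ e, f e (U e) * (linkW B (U e * (V e)⁻¹) * f' e (V e)) ∂configMeasure SU2 1) =
        ∏ e : Edge 3 1, ∫ v, f e (U e) * (linkW B (U e * v⁻¹) * f' e v) ∂haarProbability SU2 from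
      integral_fintype_prod_eq_prod (fun e v => f e (U e) * (linkW B (U e * v⁻¹) * f' e v))]
    exact Finset.prod_congr rfl fun e _ => integral_const_mul _ _
  simp_rw [inner]
  rw [show (∫ U, ∏ e, f e (U e) * ∫ v, linkW B (U e * v⁻¹) * f' e v ∂haarProbability SU2 ∂configMeasure SU2 1) =
      ∏ e : Edge 3 1, ∫ u, f e u * ∫ v, linkW B (u * v⁻¹) * f' e v ∂haarProbability SU2 ∂haarProbability SU2 from
    integral_fintype_prod_eq_prod (fun e u => f e u * ∫ v, linkW B (u * v⁻¹) * f' e v ∂haarProbability SU2)]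
  refine Finset.prod_congr rfl fun e _ => ?_
  unfold linkQ
  refine integral_congr_ae (ae_of_all _ fun u => ?_)
  beta_reduce
  rw [← integral_const_mul]
  exact integral_congr_ae (ae_of_all _ fun v => by ring)

/-- `l2` of product states factorises: `⟨⊗f, ⊗f'⟩ = ∏ₑ ∫ fₑ f'ₑ dσ`. [folklore] -/
theorem l2_linkProduct (f f' : Edge 3 1 → SU2 → ℝ) :
    l2 (fun U : Cfg => ∏ e, f e (U e)) (fun U => ∏ e, f' e (U e)) = ∏ e, ∫ u, f e u * f' e u ∂haarProbability SU2 := by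
  unfold l2
  simp_rw [← Finset.prod_mul_distrib]
  exact integral_fintype_prod_eq_prod (fun e u => f e u * f' e u)

end Summit.QuantumFields.YangMills.Theorems.FemtoTransferGap

end
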